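import Mathlib
import Summits.KontsevichZagierPeriods.Zeta5Search.CatalanQSum
import Summits.KontsevichZagierPeriods.Zeta5Search.CatalanTwoAdicXi
import Summits.KontsevichZagierPeriods.Zeta5Search.CatalanTwoAdicForm
import HarnessLib

/-!
# Catalan box family — the 2-adic TRANSFER statement (K5a) as a typed conjecture node, and its consequence

HONEST FRAMING: systematic search; no irrationality claim unless certified.

Cell `pub-zeta5`, family-designer seat `fam-catalan` (`families/catalan/TWOADIC.md` §7 (K5a), §8, §11.3).

The Catalan box period `Jsym H J K L M = Q·G + P` (`Q = catalanQ`, `P ∈ ℚ`; the real statement is the cell's conjecture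
node `CatalanQSum.CoefficientLaw`, Nesterenko/Viola in print on the admissible range) has a 2-adic shadow: the defining
series `Σ_ν t_{L+ν} R(L+ν)` converges in `ℚ₂` to `J2 H J K L M` (`CatalanTwoAdicForm`, exact norm `2^{-v₀(J,L)}` PROVED there),
and the partial-fraction reduction that produces `(P, Q)` over ℝ transfers verbatim to `ℚ₂` with `8G = Σ t_μ/(μ+½)` replaced
by `8ξ` (`CatalanTwoAdicXi.xi`) and `Σ_{ν≥1} t_ν/ν = 4` holding in both completions (`CatalanTwoAdicTelescope`).  The outcome,
PROVED ON PAPER in TWOADIC.md §7 and checked to 223–300 bits on 2 353 parameter sets (F13), is the TRANSFER LAW below: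
the SAME rational `P` serves both worlds.  It is filed here as a `@[conjecture]` node (OURS; paper-proved, not kernel-proved —
the kernel proof needs the series development of `Jsym`, cf. `Denom.CatalanQBridgeProof` for the `Q`-half), together with the
kernel-checked consequence used by the 2-adic irrationality-measure chains of §11.3: the linear forms `P + ξQ` with the
Catalan forms' own coefficients are NONZERO with EXACT 2-adic size `2^{-v₀(J,L)}`, `v₀ = 2(J+L)+2−s₂(J)−s₂(L)`.
Nothing here is an irrationality claim about `G`; `ξ ∉ ℚ` (= `ζ₂(2) ∉ ℚ`, Calegari 2005) is NOT used or claimed.  0 sorry.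
-/

namespace Summit.KontsevichZagierPeriods.Zeta5Search.CatalanTwoAdicSeries

open Literature.NumberTheory.Irrationality.Nesterenko2016 (Jsym)
open Literature.NumberTheory.Transcendental (catalanConstant)
open Summit.KontsevichZagierPeriods.Zeta5Search.CatalanQSum (catalanQ CoefficientLaw)

/-- **Transfer law (K5a; OURS, proved on paper, TWOADIC.md §7; numerically exact on 2 353 parameter sets):** on the cell's box
(`H ≤ K+L`, `J ≤ L+M`, `K ≤ M+H`, `L ≤ H+J`, `M+1 ≤ J+K`) there is ONE rational `P` with `Jsym = Q·G + P` over ℝ AND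
`J2 = P + ξ·Q` in `ℚ₂`, `Q = catalanQ H J K L M`. -/
@[conjecture] def TwoAdicTransfer : Prop :=
  ∀ H J K L M : ℕ, H ≤ K + L → J ≤ L + M → K ≤ M + H → L ≤ H + J → M + 1 ≤ J + K →
    ∃ P : ℚ, Jsym H J K L M = (catalanQ H J K L M : ℝ) * catalanConstant + (P : ℝ)
      ∧ J2 H J K L M = ((P : ℚ) : ℚ_[2]) + xi * ((catalanQ H J K L M : ℚ) : ℚ_[2])

/-- The transfer law contains the real coefficient law. -/
theorem coefficientLaw_of_twoAdicTransfer (hT : TwoAdicTransfer) : CoefficientLaw := by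
  intro H J K L M h1 h2 h3 h4 h5
  obtain ⟨P, hP, -⟩ := hT H J K L M h1 h2 h3 h4 h5
  exact ⟨P, hP⟩

/-- **Consequence (input (ii) of the 2-adic criterion, TWOADIC §11.3):** under the transfer law, the linear form `P + ξQ` built
from the Catalan form's own coefficients is nonzero and has EXACT 2-adic norm `2^{-v₀(J,L)}` — by `norm_J2` / `J2_ne_zero`. -/
theorem linearForm_norm_of_twoAdicTransfer (hT : TwoAdicTransfer) {H J K L M : ℕ} (h1 : H ≤ K + L) (h2 : J ≤ L + M)
    (h3 : K ≤ M + H) (h4 : L ≤ H + J) (h5 : M + 1 ≤ J + K) :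
    ∃ P : ℚ, Jsym H J K L M = (catalanQ H J K L M : ℝ) * catalanConstant + (P : ℝ)
      ∧ ((P : ℚ) : ℚ_[2]) + xi * ((catalanQ H J K L M : ℚ) : ℚ_[2]) ≠ 0
      ∧ ‖((P : ℚ) : ℚ_[2]) + xi * ((catalanQ H J K L M : ℚ) : ℚ_[2])‖ = (2 : ℝ) ^ (-v0 J L) := by
  obtain ⟨P, hP, h2adic⟩ := hT H J K L M h1 h2 h3 h4 h5
  refine ⟨P, hP, ?_, ?_⟩
  · rw [← h2adic]; exact J2_ne_zero H J K L M
  · rw [← h2adic]; exact norm_J2 H J K L M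

/-- The rational part is then UNIQUE (it is `J2 − ξQ`), so every archimedean / denominator statement about 'the' `P` of the
real decomposition applies to the 2-adic one. -/
theorem transfer_P_unique {H J K L M : ℕ} {P P' : ℚ}
    (hP : J2 H J K L M = ((P : ℚ) : ℚ_[2]) + xi * ((catalanQ H J K L M : ℚ) : ℚ_[2]))
    (hP' : J2 H J K L M = ((P' : ℚ) : ℚ_[2]) + xi * ((catalanQ H J K L M : ℚ) : ℚ_[2])) : P = P' := by
  have h : ((P : ℚ) : ℚ_[2]) = ((P' : ℚ) : ℚ_[2]) := by
    have := hP.symm.trans hP'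
    exact add_right_cancel this
  exact_mod_cast h

open Summit.KontsevichZagierPeriods.Zeta5Search.CatalanQSum (twoAdicLaw_holds) in
/-- On the diagonal `(n,n,n,n,n)`, `n ≥ 1`, the coefficient `Q_n ≠ 0` (its 2-adic valuation `3 − 4n + 2s₂(n)` is odd, by
`twoAdicLaw_holds`, p238507). -/
theorem catalanQ_diagonal_ne_zero {n : ℕ} (hn : 1 ≤ n) : catalanQ n n n n n ≠ 0 := by
  intro h0
  have hlaw := twoAdicLaw_holds n n n n n (by omega) (by omega) (by omega) (by omega) (by omega)
  rw [h0, padicValRat.zero] at hlaw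
  have hs : n + n - n = n := by omega
  rw [hs] at hlaw
  omega

open Summit.KontsevichZagierPeriods.Zeta5Search.CatalanQSum (twoAdicLaw_holds) in
/-- **Zudilin's diagonal, 2-adically (conditional on the transfer law; OBSERVED-EXACT for `n ≤ 60`, TWOADIC §3 / F12):**
for `n ≥ 1` the rational `P_n/Q_n` of the diagonal Catalan form satisfies `‖P_n/Q_n + ξ‖₂ = 2^{−(8n − 1 − 4 s₂(n))}` —
i.e. `P_n/Q_n → −ξ` in `ℚ₂` with the exact valuation law `8n − 1 − 4s₂(n)` (by `DiagonalLaw`/`diagonal_eq_zudilin_u`,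
`Q_n = 8(−1)ⁿuₙ` with Zudilin's 2003 `uₙ`).  Kernel inputs: `norm_J2` (p240360) and `twoAdicLaw_holds` (p238507). -/
theorem diagonal_ratio_norm_of_twoAdicTransfer (hT : TwoAdicTransfer) {n : ℕ} (hn : 1 ≤ n) :
    ∃ P : ℚ, Jsym n n n n n = (catalanQ n n n n n : ℝ) * catalanConstant + (P : ℝ)
      ∧ ‖((P / catalanQ n n n n n : ℚ) : ℚ_[2]) + xi‖
          = (2 : ℝ) ^ (-(8 * (n : ℤ) - 1 - 4 * ((Nat.digits 2 n).sum : ℤ))) := by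
  obtain ⟨P, hP, hne, hnorm⟩ :=
    linearForm_norm_of_twoAdicTransfer hT (H := n) (J := n) (K := n) (L := n) (M := n)
      (by omega) (by omega) (by omega) (by omega) (by omega)
  refine ⟨P, hP, ?_⟩
  have hQ : catalanQ n n n n n ≠ 0 := catalanQ_diagonal_ne_zero hn
  have hQ2 : ((catalanQ n n n n n : ℚ) : ℚ_[2]) ≠ 0 := by exact_mod_cast hQ
  have hlaw := twoAdicLaw_holds n n n n n (by omega) (by omega) (by omega) (by omega) (by omega)
  have hs : n + n - n = n := by omega
  rw [hs] at hlaw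
  have hrew : ((P / catalanQ n n n n n : ℚ) : ℚ_[2]) + xi
      = (((P : ℚ) : ℚ_[2]) + xi * ((catalanQ n n n n n : ℚ) : ℚ_[2])) / ((catalanQ n n n n n : ℚ) : ℚ_[2]) := by
    push_cast
    rw [div_add' _ _ _ hQ2]
  rw [hrew, norm_div, hnorm, norm_ratCast_eq _ hQ, hlaw, ← zpow_sub₀ (by norm_num : (2 : ℝ) ≠ 0)]
  congr 1
  unfold v0
  push_cast
  ring

end Summit.KontsevichZagierPeriods.Zeta5Search.CatalanTwoAdicSeries
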